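import Summits.Parity.BatemanHorn.Theorems.SoloInformedTauRhoEulerMajorant
import Summits.Parity.BatemanHorn.Theorems.SoloInformedPrimePowerLayer
import Literature.NumberTheory.Sieve.DivisorBound

/-!
# Erdős's bound `∑_{n ≤ x} τ(|g(n)|) ≪ x log x`: Mertens constants and parameter bookkeeping

Solo informed line (Parity / Bateman–Horn), session 139.  The inputs of the final assembly of the
Shiu–Nair class estimates (`SoloInformedErdosNairClassI–IV`) at the parameters `w = N^{1/8}`,
`z = w² = N^{1/4}`:

* `exists_log_mul_prod_primesBelow_le` — **Mertens along `g`, upper form**: some `K_up` has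
  `log u · ∏_{p < u}(1 − ρ_g(p)/p) ≤ K_up` for all real `u ≥ 2` (from the tree's PROVED
  `BatemanHornMertens.tendsto_log_mul_prod_one_sub_rootCount_single`);
* `exists_pos_le_log_mul_prod_primesLE_floor`, `exists_inv_sq_prod_le` — the lower form at a real
  level: `(∏_{p ≤ ⌊z⌋}(1 − ρ_g(p)/p))⁻² ≤ (log z / c)²` for `z ≥ 2`;
* `exists_eval_le_exp` — `|g(n)| ≤ exp(d log N + C_g)` on `[1, N]`; `exists_card_divisors_eval_le` —
  `τ(|g(n)|) ≤ C_F N^{1/96}` on `[1, N]` (divisor bound `τ(m) ≤ C_ε m^ε`, `ε = 1/(96d)`);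
* `log_ratio_le_eight`, `log_ratio_le_four` — `(d log N + C)/(log N/8) ≤ 8d + ⌈8C⌉` etc.;
* `params`, `rpow_facts` — `N^{1/8} ≥ 2` for `N ≥ 256`, `log N ≤ 4N^{1/4}`, and the exponent
  arithmetic `N^{1/96}·N·N^{−1/24} ≤ N`, … used by the assembly.

Everything is PROVED; no definitions, no named facts.
-/

open Finset Real Polynomial Filter Topology

namespace Summit.Parity.BatemanHorn.Theorems

open Literature.NumberTheory.Sieve

namespace ErdosDivisor

/-! ### Mertens along `g`: upper and lower forms at real levels -/

/-- **Mertens along `g`, upper form.**  For a Bateman–Horn system `![g]` there is `K_up ≥ 0` with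
`log u · ∏_{p < u}(1 − ρ_g(p)/p) ≤ K_up` for every real `u ≥ 2`. [folklore];
[cite: BatemanHorn1962] (via the tree's Mertens theorem along `g`) -/
theorem exists_log_mul_prod_primesBelow_le {g : ℤ[X]} (hg : IsBatemanHornSystem ![g]) :
    ∃ Kup : ℝ, 0 ≤ Kup ∧ ∀ u : ℝ, 2 ≤ u →
      Real.log u * ∏ p ∈ Nat.primesBelow ⌈u⌉₊, (1 - (polyRootCountMod ![g] p : ℝ) / p) ≤ Kup := by
  have hT := BatemanHornMertens.tendsto_log_mul_prod_one_sub_rootCount_single hg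
  set Lim : ℝ := batemanHornConst ![g] * Real.exp (-Real.eulerMascheroniConstant) with hLim
  obtain ⟨n₀, hn₀⟩ := eventually_atTop.1 (hT.eventually (eventually_le_nhds (lt_add_one Lim)))
  have hLim0 : 0 < Lim :=
    mul_pos (IsBatemanHornSystem.hasBatemanHornConst_holds hg).2 (Real.exp_pos _)
  have hl2 : 0 ≤ Real.log 2 := Real.log_nonneg one_le_two
  have hn₀0 : (0 : ℝ) ≤ n₀ := Nat.cast_nonneg _
  have hln₀ : 0 ≤ Real.log ((n₀ : ℝ) + 1) := Real.log_nonneg (by linarith)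
  refine ⟨Real.log 2 + (Lim + 1) + Real.log ((n₀ : ℝ) + 1),
    add_nonneg (add_nonneg hl2 (by linarith)) hln₀, fun u hu => ?_⟩
  have hg' := hg.hasNoFixedPrimeDivisor
  have hceil : (2 : ℝ) ≤ ((⌈u⌉₊ : ℕ) : ℝ) := hu.trans (Nat.le_ceil u)
  have hceil2 : 2 ≤ ⌈u⌉₊ := by exact_mod_cast hceil
  rw [Nat.primesBelow_eq_primesLE_sub_one]
  set n : ℕ := ⌈u⌉₊ - 1 with hn
  have hn1 : 1 ≤ n := by omega
  have hn1' : (1 : ℝ) ≤ n := by exact_mod_cast hn1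
  have hn0 : (0 : ℝ) < n := by linarith
  have hun : u ≤ 2 * n := by
    have h1 : ((⌈u⌉₊ : ℕ) : ℝ) = n + 1 := by
      have : ⌈u⌉₊ = n + 1 := by omega
      rw [this]; push_cast; ring
    linarith [Nat.le_ceil u]
  set P := ∏ p ∈ Nat.primesLE n, (1 - (polyRootCountMod ![g] p : ℝ) / p) with hP
  have hP0 : 0 < P := sieveProd_pos hg' n
  have hP1 : P ≤ 1 :=
    prod_le_one (fun p hp => (one_sub_rho_div_pos hg' (Nat.prime_of_mem_primesLE hp)).le)
      fun p hp => by
        have : 0 ≤ (polyRootCountMod ![g] p : ℝ) / p := by positivity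
        linarith
  have hu0 : 0 < u := by linarith
  have hlogu : Real.log u ≤ Real.log 2 + Real.log n := by
    rw [← Real.log_mul two_ne_zero hn0.ne']
    exact Real.log_le_log hu0 hun
  have hlogn0 : 0 ≤ Real.log n := Real.log_nonneg hn1'
  have h1 : Real.log u * P ≤ Real.log 2 + Real.log n * P := by
    calc Real.log u * P ≤ (Real.log 2 + Real.log n) * P :=
          mul_le_mul_of_nonneg_right hlogu hP0.le
      _ = Real.log 2 * P + Real.log n * P := by ring
      _ ≤ Real.log 2 * 1 + Real.log n * P := by gcongr
      _ = Real.log 2 + Real.log n * P := by ring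
  by_cases hnn : n₀ ≤ n
  · have h2 : Real.log n * P ≤ Lim + 1 := hn₀ n hnn
    linarith
  · have hnle : (n : ℝ) ≤ n₀ + 1 := by
      have : n ≤ n₀ + 1 := by omega
      exact_mod_cast this
    have h2 : Real.log n * P ≤ Real.log ((n₀ : ℝ) + 1) :=
      calc Real.log n * P ≤ Real.log n * 1 := by gcongr
        _ ≤ Real.log ((n₀ : ℝ) + 1) := by
            rw [mul_one]; exact Real.log_le_log hn0 hnle
    linarith

/-- **Mertens along `g`, lower form at a real level**: some `c > 0` has
`c ≤ log z · ∏_{p ≤ ⌊z⌋}(1 − ρ_g(p)/p)` for every real `z ≥ 2`. [folklore] -/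
theorem exists_pos_le_log_mul_prod_primesLE_floor {g : ℤ[X]} (hg : IsBatemanHornSystem ![g]) :
    ∃ c : ℝ, 0 < c ∧ ∀ z : ℝ, 2 ≤ z →
      c ≤ Real.log z * ∏ p ∈ Nat.primesLE ⌊z⌋₊, (1 - (polyRootCountMod ![g] p : ℝ) / p) := by
  obtain ⟨c, hc, h⟩ := exists_pos_le_log_mul_sieveProd hg
  refine ⟨c, hc, fun z hz => ?_⟩
  have hz2 : 2 ≤ ⌊z⌋₊ := Nat.le_floor (by exact_mod_cast hz)
  have hP := sieveProd_pos hg.hasNoFixedPrimeDivisor ⌊z⌋₊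
  have hfl : Real.log ((⌊z⌋₊ : ℕ) : ℝ) ≤ Real.log z :=
    Real.log_le_log (by exact_mod_cast (by omega : 0 < ⌊z⌋₊)) (Nat.floor_le (by linarith))
  exact (h _ hz2).trans (mul_le_mul_of_nonneg_right hfl hP.le)

/-- `(∏_{p ≤ ⌊z⌋}(1 − ρ_g(p)/p))⁻² ≤ (log z / c)²` for `z ≥ 2`. [folklore] -/
theorem exists_inv_sq_prod_le {g : ℤ[X]} (hg : IsBatemanHornSystem ![g]) :
    ∃ c : ℝ, 0 < c ∧ ∀ z : ℝ, 2 ≤ z →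
      ((∏ p ∈ Nat.primesLE ⌊z⌋₊, (1 - (polyRootCountMod ![g] p : ℝ) / p)) ^ 2)⁻¹ ≤
        (Real.log z / c) ^ 2 := by
  obtain ⟨c, hc, h⟩ := exists_pos_le_log_mul_prod_primesLE_floor hg
  refine ⟨c, hc, fun z hz => ?_⟩
  have hP := sieveProd_pos hg.hasNoFixedPrimeDivisor ⌊z⌋₊
  rw [← inv_pow]
  apply pow_le_pow_left₀ (inv_nonneg.2 hP.le)
  rw [inv_eq_one_div, div_le_div_iff₀ hP hc]
  linarith [h z hz]

/-! ### The size of `|g(n)|` and of `τ(|g(n)|)` on `[1, N]` -/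

/-- `|g(n)| ≤ exp(d log N + C_g)` for `1 ≤ n ≤ N` (`d = deg g ≥ 1`). [folklore] -/
theorem exists_eval_le_exp {g : ℤ[X]} (hdeg : 0 < g.natDegree) :
    ∃ C : ℝ, 0 ≤ C ∧ ∀ N : ℕ, ∀ n ∈ Icc 1 N,
      (((g.eval (n : ℤ)).natAbs : ℕ) : ℝ) ≤ Real.exp (g.natDegree * Real.log N + C) := by
  obtain ⟨C, hC0, hC⟩ := LocatedMangoldt.exists_log_natAbs_eval_le hdeg
  refine ⟨C, hC0, fun N n hn => ?_⟩
  obtain ⟨hn1, hnN⟩ := mem_Icc.1 hn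
  rcases Nat.eq_zero_or_pos (g.eval (n : ℤ)).natAbs with h0 | hpos
  · rw [h0, Nat.cast_zero]; exact (Real.exp_pos _).le
  · calc (((g.eval (n : ℤ)).natAbs : ℕ) : ℝ) = Real.exp (Real.log ((g.eval (n : ℤ)).natAbs : ℕ)) :=
          (Real.exp_log (by exact_mod_cast hpos)).symm
      _ ≤ _ := Real.exp_le_exp.2 (hC N n hn1 hnN)

/-- `τ(|g(n)|) ≤ C_F · N^{1/96}` for `1 ≤ n ≤ N` (from `τ(m) ≤ C_ε m^ε` with `ε = 1/(96 deg g)`).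
[folklore] -/
theorem exists_card_divisors_eval_le {g : ℤ[X]} (hdeg : 0 < g.natDegree) :
    ∃ CF : ℝ, 0 ≤ CF ∧ ∀ N : ℕ, 1 ≤ N → ∀ n ∈ Icc 1 N,
      (#((g.eval (n : ℤ)).natAbs.divisors) : ℝ) ≤ CF * (N : ℝ) ^ (1 / 96 : ℝ) := by
  obtain ⟨C, hC0, hC⟩ := exists_eval_le_exp hdeg
  have hd0 : (0 : ℝ) < g.natDegree := by exact_mod_cast hdeg
  have hd0' : (g.natDegree : ℝ) ≠ 0 := hd0.ne'
  have hε : (0 : ℝ) < 1 / (96 * g.natDegree) := by positivity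
  obtain ⟨C₁, hC₁, hτ⟩ := exists_card_divisors_le_mul_rpow hε
  refine ⟨C₁ * Real.exp (C / (96 * g.natDegree)), by positivity, fun N hN n hn => ?_⟩
  have hN0 : (0 : ℝ) < N := by exact_mod_cast hN
  rcases Nat.eq_zero_or_pos (g.eval (n : ℤ)).natAbs with h0 | hpos
  · rw [h0, Nat.divisors_zero, card_empty, Nat.cast_zero]; positivity
  · have h1 := hτ _ hpos.ne'
    have hmX := hC N n hn
    have h2 : (((g.eval (n : ℤ)).natAbs : ℕ) : ℝ) ^ (1 / (96 * g.natDegree) : ℝ) ≤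
        Real.exp (C / (96 * g.natDegree)) * (N : ℝ) ^ (1 / 96 : ℝ) := by
      calc (((g.eval (n : ℤ)).natAbs : ℕ) : ℝ) ^ (1 / (96 * g.natDegree) : ℝ)
          ≤ (Real.exp (g.natDegree * Real.log N + C)) ^ (1 / (96 * g.natDegree) : ℝ) :=
            Real.rpow_le_rpow (Nat.cast_nonneg _) hmX hε.le
        _ = Real.exp (C / (96 * g.natDegree)) * (N : ℝ) ^ (1 / 96 : ℝ) := by
            rw [← Real.exp_mul, Real.rpow_def_of_pos hN0, ← Real.exp_add]
            congr 1
            field_simp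
            ring
    calc (#((g.eval (n : ℤ)).natAbs.divisors) : ℝ)
        ≤ C₁ * (((g.eval (n : ℤ)).natAbs : ℕ) : ℝ) ^ (1 / (96 * g.natDegree) : ℝ) := h1
      _ ≤ C₁ * (Real.exp (C / (96 * g.natDegree)) * (N : ℝ) ^ (1 / 96 : ℝ)) :=
          mul_le_mul_of_nonneg_left h2 (by linarith)
      _ = _ := by ring

/-! ### Parameter bookkeeping at `w = N^{1/8}`, `z = N^{1/4}` -/

/-- `(d ℓ + C)/(ℓ/8) ≤ 8d + ⌈8C⌉` for `ℓ ≥ 1`, `C ≥ 0`. [folklore] -/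
theorem log_ratio_le_eight {ℓ C : ℝ} (d : ℕ) (hℓ : 1 ≤ ℓ) (hC : 0 ≤ C) :
    (d * ℓ + C) / (ℓ / 8) ≤ ((8 * d + ⌈8 * C⌉₊ : ℕ) : ℝ) := by
  rw [div_le_iff₀ (by linarith)]
  push_cast
  have h1 := Nat.le_ceil (8 * C)
  nlinarith [mul_le_mul_of_nonneg_right h1 (by linarith : (0 : ℝ) ≤ ℓ),
    mul_nonneg hC (sub_nonneg.2 hℓ)]

/-- `(d ℓ + C)/(ℓ/4) ≤ 4d + ⌈4C⌉` for `ℓ ≥ 1`, `C ≥ 0`. [folklore] -/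
theorem log_ratio_le_four {ℓ C : ℝ} (d : ℕ) (hℓ : 1 ≤ ℓ) (hC : 0 ≤ C) :
    (d * ℓ + C) / (ℓ / 4) ≤ ((4 * d + ⌈4 * C⌉₊ : ℕ) : ℝ) := by
  rw [div_le_iff₀ (by linarith)]
  push_cast
  have h1 := Nat.le_ceil (4 * C)
  nlinarith [mul_le_mul_of_nonneg_right h1 (by linarith : (0 : ℝ) ≤ ℓ),
    mul_nonneg hC (sub_nonneg.2 hℓ)]

/-- The parameters `w = N^{1/8}`, `z = N^{1/4}` for `N ≥ 256`: `w ≥ 2`, `w·w = z`,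
`log w = (log N)/8`, `log z = (log N)/4`, `z ≤ N`, `1 ≤ log N ≤ 4 N^{1/4}`. [folklore] -/
theorem params {N : ℕ} (hN : 256 ≤ N) :
    2 ≤ (N : ℝ) ^ (1 / 8 : ℝ) ∧
    (N : ℝ) ^ (1 / 8 : ℝ) * (N : ℝ) ^ (1 / 8 : ℝ) = (N : ℝ) ^ (1 / 4 : ℝ) ∧
    Real.log ((N : ℝ) ^ (1 / 8 : ℝ)) = Real.log N / 8 ∧
    Real.log ((N : ℝ) ^ (1 / 4 : ℝ)) = Real.log N / 4 ∧
    (N : ℝ) ^ (1 / 4 : ℝ) ≤ N ∧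
    1 ≤ Real.log N ∧
    Real.log N ≤ 4 * (N : ℝ) ^ (1 / 4 : ℝ) := by
  have hN0 : (0 : ℝ) < N := by exact_mod_cast (by omega : 0 < N)
  have hN1 : (1 : ℝ) ≤ N := by exact_mod_cast (by omega : 1 ≤ N)
  have hN256 : (256 : ℝ) ≤ N := by exact_mod_cast hN
  refine ⟨?_, ?_, ?_, ?_, ?_, ?_, ?_⟩
  · have h : (2 : ℝ) = (256 : ℝ) ^ (1 / 8 : ℝ) := by
      rw [show (256 : ℝ) = (2 : ℝ) ^ ((8 : ℕ) : ℝ) by rw [Real.rpow_natCast]; norm_num,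
        ← Real.rpow_mul zero_le_two]
      norm_num
    rw [h]; exact Real.rpow_le_rpow (by norm_num) hN256 (by norm_num)
  · rw [← Real.rpow_add hN0]; norm_num
  · rw [Real.log_rpow hN0]; ring
  · rw [Real.log_rpow hN0]; ring
  · conv_rhs => rw [← Real.rpow_one (N : ℝ)]
    exact Real.rpow_le_rpow_of_exponent_le hN1 (by norm_num)
  · have h8 : Real.log 256 ≤ Real.log N := Real.log_le_log (by norm_num) hN256
    have h2 : (1 : ℝ) ≤ Real.log 256 := by
      rw [show (256 : ℝ) = 2 ^ 8 by norm_num, Real.log_pow]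
      have := Real.log_two_gt_d9
      push_cast
      linarith
    linarith
  · have h := Real.log_le_rpow_div hN0.le (by norm_num : (0 : ℝ) < 1 / 4)
    have h4 : (N : ℝ) ^ (1 / 4 : ℝ) / (1 / 4) = 4 * (N : ℝ) ^ (1 / 4 : ℝ) := by ring
    linarith

/-- Exponent arithmetic at `t = N ≥ 1` (`w = t^{1/8}`, `z = t^{1/4}`). [folklore] -/
theorem rpow_facts {t : ℝ} (ht : 1 ≤ t) :
    t ^ (1 / 4 : ℝ) * t ^ (1 / 4 : ℝ) = t ^ (1 / 2 : ℝ) ∧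
    (t ^ (1 / 8 : ℝ)) ^ 2 * t ^ (1 / 4 : ℝ) = t ^ (1 / 2 : ℝ) ∧
    t ^ (1 / 2 : ℝ) * t ^ (1 / 4 : ℝ) ≤ t ∧
    (t ^ (1 / 4 : ℝ)) ^ (2 / 3 : ℝ) * t ^ (1 / 4 : ℝ) * t ^ (1 / 2 : ℝ) ≤ t ∧
    t ^ (1 / 96 : ℝ) * t * (t ^ (1 / 8 : ℝ)) ^ (-(1 / 3) : ℝ) ≤ t ∧
    t ^ (1 / 96 : ℝ) * t ^ (1 / 8 : ℝ) ≤ t ∧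
    t ^ (1 / 96 : ℝ) * (t ^ (1 / 8 : ℝ)) ^ (-(1 / 6) : ℝ) ≤ 1 := by
  have ht0 : 0 < t := by linarith
  have hle : ∀ a : ℝ, a ≤ 1 → t ^ a ≤ t := fun a ha => by
    conv_rhs => rw [← Real.rpow_one t]
    exact Real.rpow_le_rpow_of_exponent_le ht ha
  refine ⟨?_, ?_, ?_, ?_, ?_, ?_, ?_⟩
  · rw [← Real.rpow_add ht0]; norm_num
  · rw [← Real.rpow_natCast, ← Real.rpow_mul ht0.le, ← Real.rpow_add ht0]; norm_num
  · rw [← Real.rpow_add ht0]; exact hle _ (by norm_num)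
  · rw [← Real.rpow_mul ht0.le, ← Real.rpow_add ht0, ← Real.rpow_add ht0]; exact hle _ (by norm_num)
  · rw [← Real.rpow_add_one ht0.ne', ← Real.rpow_mul ht0.le, ← Real.rpow_add ht0]
    exact hle _ (by norm_num)
  · rw [← Real.rpow_add ht0]; exact hle _ (by norm_num)
  · rw [← Real.rpow_mul ht0.le, ← Real.rpow_add ht0, ← Real.rpow_zero t]
    exact Real.rpow_le_rpow_of_exponent_le ht (by norm_num)

end ErdosDivisor

end Summit.Parity.BatemanHorn.Theorems
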